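import Summits.CriticalPhenomena.PercolationContinuityZ3.Theorems.PercNearOneGluingNoHeavyLowerTailSahiE3TriSaturation
import Summits.CriticalPhenomena.PercolationContinuityZ3.Theorems.PercNearOneGluingNoHeavyLowerTailSahiC3CubeThreeFKGPrelim
import Mathlib.Tactic.Linarith
import HarnessLib
import HarnessLib.Audit

/-!
# `NoHeavyLowerTail` (crux stmt-CriticalPhenomena-4575), Sahi programme P4: tri-saturation read on set codes (one direction)

Support file (cell `prim-l12`, seat P4; `--supports stmt-CriticalPhenomena-4575`).  No named facts, no sorries; standard axioms.

For the assembly of Sahi's `C₃` on `{0,1}⁴` under FKG weights (HOME prim-l12-p4/ASSEMBLY-PLAN-FKG-CUBE4.md) the reduction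
`C3Transport.forall_latticeE3_nonneg_of_triSaturated` hands us a TRI-SATURATED triple of up-sets; the kernel table that classifies triples works on
codes (`encF m`).  This file provides the only bridge needed in that direction: `TriSaturated U A B` implies, for each slot `S` with core
`K` (= the meet of the other two slots), the two code-level closure properties
`∀ x < 2^m, (∀ y < 2^m, y ∈ K → x ⊆ y → y ∈ S) → x ∈ S` (core saturation) and `∀ x < 2^m, (∃ y < 2^m, y ∈ S ∧ y ∉ K ∧ y ⊆ x) → x ∈ S`
(generator saturation), where membership of a code is a bit of `encF` and `x ⊆ y` is `x AND y = x` (`ptB_le_ptB_iff`).  These are bounded, decidable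
statements, so a `decide`/`native_decide` scan over code triples can discard every triple violating them.
-/

namespace Summit.CriticalPhenomena.PercolationContinuityZ3.Theorems.SahiC3CubeFourFKG

open Finset Literature.Probability.LatticeModels SahiC3Cube OneCutCert C3Transport

/-- The order of coded cube points is bitwise inclusion of the codes. [this work] -/
theorem ptB_le_ptB_iff {m x y : ℕ} (hx : x < 2 ^ m) : ptB m x ≤ ptB m y ↔ x &&& y = x := by
  constructor
  · intro h
    refine Nat.eq_of_testBit_eq fun i => ?_
    rw [Nat.testBit_land]
    by_cases hi : i < m
    · have hle : x.testBit i ≤ y.testBit i := h ⟨i, hi⟩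
      cases hxi : x.testBit i
      · simp
      · rw [hxi] at hle; simpa using top_le_iff.1 hle
    · have hle : 2 ^ m ≤ 2 ^ i := Nat.pow_le_pow_right (by norm_num) (not_lt.1 hi)
      simp [Nat.testBit_lt_two_pow (lt_of_lt_of_le hx hle)]
  · intro h i
    show x.testBit i ≤ y.testBit i
    have := congrArg (fun n => n.testBit (i : ℕ)) h
    simp only [Nat.testBit_land] at this
    cases hxi : x.testBit i
    · exact bot_le
    · rw [hxi, Bool.true_and] at this; rw [this]

/-- A coded point is in `S` iff the corresponding bit of `encF m S` is set. [this work] -/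
theorem ptB_mem_iff {m : ℕ} (S : Finset (Fin m → Bool)) {x : ℕ} (hx : x < 2 ^ m) : ptB m x ∈ S ↔ (encF m S).testBit x = true := by
  rw [testBit_encF]; simp [hx]

variable {m : ℕ} [DecidableLE (Fin m → Bool)]

/-- **Core saturation on codes**: if `coreSat A B S = S` then every code `x` all of whose `K`-supersets (`K = A ∩ B`) lie in `S` lies in `S`.
[this work] -/
theorem code_closure_of_coreSat_eq {A B S : Finset (Fin m → Bool)} (h : coreSat A B S = S) :
    ∀ x < 2 ^ m, (∀ y < 2 ^ m, (encF m (A ∩ B)).testBit y = true → x &&& y = x → (encF m S).testBit y = true) →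
      (encF m S).testBit x = true := by
  intro x hx H
  rw [← ptB_mem_iff S hx, ← h, mem_coreSat]
  intro y hy hle
  have hy' : (encF m (A ∩ B)).testBit (enc2 y) = true := (mem_iff_testBit_encF _ _).1 hy
  have hle' : x &&& enc2 y = x := (ptB_le_ptB_iff hx).1 (by rwa [ptB_enc2])
  exact (mem_iff_testBit_encF S y).2 (H _ (enc2_lt y) hy' hle')

/-- **Generator saturation on codes**: if `genSat A B S = S` then every code above a member of `S` outside `K = A ∩ B` lies in `S`. [this work] -/
theorem code_closure_of_genSat_eq {A B S : Finset (Fin m → Bool)} (h : genSat A B S = S) :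
    ∀ x < 2 ^ m, (∃ y < 2 ^ m, (encF m S).testBit y = true ∧ (encF m (A ∩ B)).testBit y = false ∧ y &&& x = y) →
      (encF m S).testBit x = true := by
  rintro x hx ⟨y, hy, hyS, hyK, hle⟩
  rw [← ptB_mem_iff S hx, ← h, mem_genSat]
  refine ⟨ptB m y, Finset.mem_sdiff.2 ⟨(ptB_mem_iff S hy).2 hyS, fun hK => ?_⟩, (ptB_le_ptB_iff hy).2 hle⟩
  rw [(ptB_mem_iff (A ∩ B) hy).1 hK] at hyK
  exact Bool.noConfusion hyK

/-- **Tri-saturation on codes** (the direction used by the assembly table): the six closure properties of the codes of a tri-saturated triple.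
[this work] -/
theorem code_closures_of_triSaturated {U A B : Finset (Fin m → Bool)} (h : TriSaturated U A B) :
    (∀ x < 2 ^ m, (∀ y < 2 ^ m, (encF m (A ∩ B)).testBit y = true → x &&& y = x → (encF m U).testBit y = true) →
        (encF m U).testBit x = true) ∧
    (∀ x < 2 ^ m, (∃ y < 2 ^ m, (encF m U).testBit y = true ∧ (encF m (A ∩ B)).testBit y = false ∧ y &&& x = y) →
        (encF m U).testBit x = true) ∧
    (∀ x < 2 ^ m, (∀ y < 2 ^ m, (encF m (U ∩ B)).testBit y = true → x &&& y = x → (encF m A).testBit y = true) →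
        (encF m A).testBit x = true) ∧
    (∀ x < 2 ^ m, (∃ y < 2 ^ m, (encF m A).testBit y = true ∧ (encF m (U ∩ B)).testBit y = false ∧ y &&& x = y) →
        (encF m A).testBit x = true) ∧
    (∀ x < 2 ^ m, (∀ y < 2 ^ m, (encF m (U ∩ A)).testBit y = true → x &&& y = x → (encF m B).testBit y = true) →
        (encF m B).testBit x = true) ∧
    (∀ x < 2 ^ m, (∃ y < 2 ^ m, (encF m B).testBit y = true ∧ (encF m (U ∩ A)).testBit y = false ∧ y &&& x = y) →
        (encF m B).testBit x = true) :=
  ⟨code_closure_of_coreSat_eq h.1.1, code_closure_of_genSat_eq h.1.2, code_closure_of_coreSat_eq h.2.1.1, code_closure_of_genSat_eq h.2.1.2,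
    code_closure_of_coreSat_eq h.2.2.1, code_closure_of_genSat_eq h.2.2.2⟩

end Summit.CriticalPhenomena.PercolationContinuityZ3.Theorems.SahiC3CubeFourFKG
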